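import Literature.Probability.LatticeModels.CollarLegModelConfigs

/-!
# Stub `stub_realisability` of line `rainbow-monomials-in-excursion-kernels` — Part 10:
# heights are determined by their arrows, for a general collar leg model
# (crux `BoundaryDefectGaussianR`, stmt-CriticalPhenomena-14132; insertion dictionary D2, layer 3a)

For a general `Literature.Probability.LatticeModels.CollarLegModel` `M` (wired arcs, ghosts,
pockets, jump collar — not only the closed collar `ofDomain V` of Part 2) a height configuration
`h : M.freeCells → ℤ` is read by the insertion dictionary D2 through its ARROWS: the height
differences `M.hv h x - M.hf h f` across the tracked corners `(x, f)`, `x` a vertex-cell, `f` a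
face-cell at `x`. This file proves the injectivity half of that change of variables:

* `hv_eq_of_hdiff_eq_of_exit` — at a vertex `a ∈ V` whose eastern neighbour is outside `V`, two
  configurations with the same differences have the same height: the north-east face `a` is then
  either prescribed (a collar face) or a pocket whose south-east corner `a + (1,0) ∉ V` is a ghost,
  a prescribed vertex-cell;
* `hv_eq_of_hdiff_eq_aux`, `hv_eq_of_hdiff_eq` — hence at every vertex of `V`, by induction on the
  distance to the eastern exit from `V` along the row of `a` (walk east through the faces `a`,
  `a + (1,0)`, …, each shared by two consecutive vertices of the row);
* `hf_eq_of_hdiff_eq` — and at every face-cell (it has a corner in `V`);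
* `heights_eq_of_hdiff_eq` — **injectivity**: two height configurations with the same height
  difference across every tracked corner are equal. No validity hypothesis is needed.

This generalises `heights_eq_of_arrows_eq` of Part 2 (closed collar, arrow bits of valid
configurations). Registered sub-goal carried here: `s13_heightsFromArrows`.
-/

namespace Summit.CriticalPhenomena.CardyFormulaZ2.Cruxes.BoundaryDefectGaussianR.RainbowMonomialsInExcursionKernels

open Finset Literature.Probability.LatticeModels Literature.Probability.LatticeModels.CollarLegModel

section HeightsFromArrows

variable {M : CollarLegModel} {h₁ h₂ : ↥M.freeCells → ℤ}
  (hd : ∀ x ∈ M.vertexCells, ∀ f ∈ SixVertex.vertexFaces x, f ∈ M.faceCells →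
    M.hv h₁ x - M.hf h₁ f = M.hv h₂ x - M.hf h₂ f)
include hd

/-- **Exit step**: at a vertex `a ∈ V` with `a + (1,0) ∉ V` the two heights agree — the north-east
face `a` is not interior, so it is prescribed or a pocket with the ghost corner `a + (1,0)`. [folklore] -/
theorem hv_eq_of_hdiff_eq_of_exit {a : ℤ × ℤ} (ha : a ∈ M.V) (hout : (a.1 + 1, a.2) ∉ M.V) :
    M.hv h₁ a = M.hv h₂ a := by
  have hfc : a ∈ M.faceCells := mem_faceCells_of_mem_vertexFaces M ha (self_mem_vertexFaces a)
  have e1 := hd a (mem_union_left _ ha) a (self_mem_vertexFaces a) hfc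
  suffices M.hf h₁ a = M.hf h₂ a by omega
  by_cases hfree : (a, true) ∈ M.freeCells
  · rw [mem_freeCells_true, freeFaces, mem_union] at hfree
    have hse : (a.1 + 1, a.2) ∈ SixVertex.faceCorners a := by simp [SixVertex.faceCorners]
    rcases hfree with hint | hpoc
    · exact absurd ((mem_filter.1 hint).2 hse) hout
    · have hg : (a.1 + 1, a.2) ∈ M.ghosts :=
        mem_sdiff.2 ⟨mem_union_right _ (mem_biUnion.2 ⟨a, hpoc, hse⟩), hout⟩
      have hgfree : ((a.1 + 1, a.2), false) ∉ M.freeCells := by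
        rw [mem_freeCells_false]
        exact fun h' => hout (mem_sdiff.1 h').1
      have e2 := hd _ (mem_union_right _ hg) a (mem_vertexFaces_of_mem_faceCorners hse) hfc
      rw [hv_of_not_mem M _ hgfree, hv_of_not_mem M _ hgfree] at e2
      omega
  · rw [hf_of_not_mem M _ hfree, hf_of_not_mem M _ hfree]

/-- **Walking east**: the two heights agree at every vertex `a ∈ V` at distance at most `n` from
the eastern end of its row in `V` (induction on `n`; the face `a` is shared by the corners `a` and
`a + (1,0)`). [folklore] -/
theorem hv_eq_of_hdiff_eq_aux :
    ∀ n : ℕ, ∀ a ∈ M.V, (∀ b ∈ M.V, b.2 = a.2 → b.1 ≤ a.1 + n) → M.hv h₁ a = M.hv h₂ a := by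
  intro n
  induction n with
  | zero =>
    intro a ha hb
    exact hv_eq_of_hdiff_eq_of_exit hd ha fun h => by have := hb _ h rfl; simp at this
  | succ n ih =>
    intro a ha hb
    by_cases hout : (a.1 + 1, a.2) ∈ M.V
    · have e1 := ih _ hout fun b hb' hb2 => by have := hb b hb' hb2; simp only at this ⊢; omega
      have hfc : a ∈ M.faceCells := mem_faceCells_of_mem_vertexFaces M ha (self_mem_vertexFaces a)
      have hse : (a.1 + 1, a.2) ∈ SixVertex.faceCorners a := by simp [SixVertex.faceCorners]
      have e2 := hd _ (mem_union_left _ hout) a (mem_vertexFaces_of_mem_faceCorners hse) hfc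
      have e3 := hd a (mem_union_left _ ha) a (self_mem_vertexFaces a) hfc
      omega
    · exact hv_eq_of_hdiff_eq_of_exit hd ha hout

/-- The two heights agree at every vertex of `V`. [folklore] -/
theorem hv_eq_of_hdiff_eq {a : ℤ × ℤ} (ha : a ∈ M.V) : M.hv h₁ a = M.hv h₂ a := by
  obtain ⟨N, hN⟩ : ∃ N : ℕ, ∀ a ∈ M.V, ∀ b ∈ M.V, b.1 ≤ a.1 + N := by
    obtain ⟨K, hK⟩ := Finset.bddAbove (M.V.image Prod.fst)
    obtain ⟨m, hm⟩ := Finset.bddBelow (M.V.image Prod.fst)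
    refine ⟨(K - m).toNat, fun a ha b hb => ?_⟩
    have e1 : b.1 ≤ K := hK (mem_coe.2 (mem_image_of_mem _ hb))
    have e2 : m ≤ a.1 := hm (mem_coe.2 (mem_image_of_mem _ ha))
    have e3 : K - m ≤ ((K - m).toNat : ℤ) := Int.self_le_toNat _
    omega
  exact hv_eq_of_hdiff_eq_aux hd N a ha fun b hb _ => hN a ha b hb

/-- The two heights agree at every face-cell (it has a corner in `V`). [folklore] -/
theorem hf_eq_of_hdiff_eq {f : ℤ × ℤ} (hf : f ∈ M.faceCells) : M.hf h₁ f = M.hf h₂ f := by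
  obtain ⟨v, hv, hfv⟩ := mem_biUnion.1 hf
  have e1 := hd v (mem_union_left _ hv) f hfv hf
  have e2 := hv_eq_of_hdiff_eq hd hv
  omega

/-- **Injectivity of heights ↦ arrows**: two height configurations of a collar leg model with the
same height difference across every tracked corner (vertex-cell, adjacent face-cell) are equal —
every free cell is joined through tracked corners, walking east, to a prescribed cell. [folklore] -/
theorem heights_eq_of_hdiff_eq : h₁ = h₂ := by
  funext c
  obtain ⟨⟨x, b⟩, hc⟩ := c
  cases b
  · have hx : x ∈ M.V := (mem_sdiff.1 ((mem_freeCells_false M).1 hc)).1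
    have := hv_eq_of_hdiff_eq hd hx
    rwa [hv_of_mem _ _ hc, hv_of_mem _ _ hc] at this
  · have hx : x ∈ M.faceCells := by
      have hfree := (mem_freeCells_true M).1 hc
      rw [freeFaces, mem_union] at hfree
      rcases hfree with hint | hpoc
      · exact (mem_filter.1 hint).1
      · exact (mem_filter.1 (mem_inter.1 hpoc).2).1
    have := hf_eq_of_hdiff_eq hd hx
    rwa [hf_of_mem _ _ hc, hf_of_mem _ _ hc] at this

end HeightsFromArrows

/-! ### Registered sub-goal of this Part -/

/-- **Sub-goal `s13_heightsFromArrows`** (registered on stmt-CriticalPhenomena-14132): for every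
collar leg model `M`, two height configurations `h₁ h₂ : M.freeCells → ℤ` with
`hv h₁ x - hf h₁ f = hv h₂ x - hf h₂ f` for every vertex-cell `x` and every face-cell `f` at `x`
are equal (D2, layer 3a: heights are determined by their arrows). [folklore] -/
theorem s13_heightsFromArrows : ∀ (M : Literature.Probability.LatticeModels.CollarLegModel) (h₁ h₂ : ↥M.freeCells → ℤ), (∀ x ∈ M.vertexCells, ∀ f ∈ Literature.Probability.LatticeModels.SixVertex.vertexFaces x, f ∈ M.faceCells → M.hv h₁ x - M.hf h₁ f = M.hv h₂ x - M.hf h₂ f) → h₁ = h₂ :=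
  fun _ _ _ hd => heights_eq_of_hdiff_eq hd

end Summit.CriticalPhenomena.CardyFormulaZ2.Cruxes.BoundaryDefectGaussianR.RainbowMonomialsInExcursionKernels
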